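import Summits.BirchSwinnertonDyer.BirchSwinnertonDyer.Theorems.ByReductionTypeAtTwoOrdKatoHalfAtTwoIsoPosDiscNecessity
import Summits.BirchSwinnertonDyer.BirchSwinnertonDyer.Theorems.AlignedTransportAtTwoMainConjectureOfRankZeroBSDAtTwoMuNecessity
import Summits.BirchSwinnertonDyer.BirchSwinnertonDyer.Theorems.AlignedTransportAtTwoAnalyticMuBinderDischarge
import Literature.NumberTheory.EllipticCurves.IsogenyIdProofs
import HarnessLib

/-!
# Route `AlignedTransportAtTwo`, crux C2 `MainConjectureOfRankZeroBSDAtTwo` (stmt-BirchSwinnertonDyer-22298) IS A COROLLARY,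
# modulo PRINT, of route `ByReductionTypeAtTwo`'s crux 202 `OrdKatoHalfAtTwoIso` (stmt-BirchSwinnertonDyer-19573) — and conversely
# C2 gives crux 202's conclusion on the seed cell with `BSD₂` (a two-routes BRIDGE, by name, kernel-checked)

HONEST FRAMING (cell `bsd-f1-sign2`, WIDTH-5 attached prover seat `bsd-line-att-p5` gen 23 on line `birth` of the lead
`bsd-line-att-p2`; `--supports` stmt-BirchSwinnertonDyer-22298, closes nothing; BSD is NOT proved by any of this; neither crux is proved;
the C2 verdict «blocked-on `Rank1Residual.GreenbergMuConjectureIrreducible`» and every registered stub are untouched). THEOREMS ONLY — no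
definition, no named fact, no `sorry`; every deep input is a DISPLAYED hypothesis: `OrdPublishedInputsAtTwo` (= K4 item 19149: modularity,
GZK, Kato 17.4 (1)(2) at `2`, Greenberg 4.1), Cassels' isogeny invariance `bsdRHS_eq_of_isIsogenous`, Abbes–Ullmo
`abbesUllmo_not_dvd_maninConstant_of_not_dvd_level` (six PRINT facts), and the other route's crux (OPEN, research-grade).

WHY. Road (c) of line `birth` (lead att-p2 g3, `…KatoMuRoad`) reads «C2 ⟺ (∀ seed `W`, `X5.O1.KatoMuPartAtTwo W`) modulo P». Cell bsd-2adic
(crux 202, LEAD `cruxlead-19573` g6, `…OrdKatoHalfAtTwoIsoPosDiscNecessity`, and seat ord-3 `…OrdIsogenyTransport`) has since made kernel: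
(i) the Kato–Néron half `X5.O1.MainConjectureLowerDivisibilityAtTwoOrd` is an ISOGENY-CLASS statement on the rank-`0` good-ordinary domain
(`katoHalf_isogenyInvariant`, PUB + Cassels); (ii) the half ⟹ the `μ`-part (`X5.O1.katoMuPartAtTwo_of_mainConjectureLowerDivisibilityAtTwoOrd`,
Kato 17.4 (1)); (iii) the `μ`-part ⟹ `μ(X(W/ℚ_∞)) = 0` for `E[2]` irreducible (`mu_eq_zero_of_katoMuPartAtTwo_of_irr`: Abbes–Ullmo period
unit + the tree's ANALYTIC `μ₂ = 0` theorem `AnalyticMuTwo.exists_norm_padicLCoeff_two_eq_one`, cell bsd-2adic tower-1 g24). Crux 202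
`OrdKatoHalfAtTwoIso` asserts the half at SOME isogenous minimal curve for every non-CM `W` of analytic rank `0`, good ordinary at `2` —
a SUPERSET of C2's seed cell. Hence:

* §1 (per curve) `mainConjectureLowerDivisibilityAtTwoOrd_of_mazurMainConjecture_two` (equality ⟹ divisibility, bookkeeping);
  **`selmerDual_mu_eq_zero_of_lowerDivisibility_of_forall_not_hasRationalTwoTorsionX`** — PUB-shaped facts + Abbes–Ullmo + the half AT `W`
  ⟹ `μ = 0` at every normalised cyclotomic Selmer dual datum of a good-ordinary-at-`2` curve with no rational `2`-torsion abscissa;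
  **`mazurMainConjecture_two_of_ordKatoHalfAtTwoIso`** — + Cassels + crux 202 + `r_an = 0`, `BSD₂(W)` ⟹ `MC₂(W)` (p583329's engine).
* §2 (the cells) **`mainConjectureOfRankZeroBSDAtTwo_of_ordKatoHalfAtTwoIso`**: `OrdPublishedInputsAtTwo → bsdRHS_eq_of_isIsogenous →
  abbesUllmo_… → OrdKatoHalfAtTwoIso → MainConjectureOfRankZeroBSDAtTwo` — **C2 BY NAME from crux 202 BY NAME and six print facts**
  (C2's binders `Δ ∉ ℚ²` and the even-branch `μ(L₂) = 0` are idle here); and **`…_of_ordKatoHalfAtTwoIsoPosDisc`**: on the `0 < Δ_W` half of the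
  seed cell C2's conclusion follows from the REGISTERED conjunct `OrdKatoHalfAtTwoIsoPosDisc` of the PAIR child stmt-BirchSwinnertonDyer-24097
  (seed cell ⟹ `ρ̄_{W,2}` onto: Dokchitser–Dokchitser `hasSurjectiveModNGaloisRep_two_iff`).
* §3 (converse) **`lowerDivisibility_on_seedCell_of_mainConjectureOfRankZeroBSDAtTwo`**: C2 ⟹ the Kato–Néron half AT `W` (with `W' := W`)
  for every seed-cell curve with `BSD₂(W)` — crux 202's conclusion on {seed cell ∧ `BSD₂`}, the analytic-`μ` binder of C2 being discharged by
  att-p3 g10 / bsd-2adic (`muFree_of_mainConjectureOfRankZeroBSDAtTwo`).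

LEDGER READING (for the planner-of-record / director; nothing asserted): modulo PRINT⁶, **C2 (22298) ⟸ crux 202 (19573)**, and on the
sub-cell {`ρ̄₂` onto, `r_an = 0`, good ordinary at `2`, non-CM, `BSD₂`} the two cruxes assert the same thing (the Kato–Néron half at `W`
⟺ `MC₂(W)` there, by p583329 and §1). So C2's obligation node is contained in crux 202's; the cell's own roads ((b″) small carrier, p736077;
road (c)) remain the routes THROUGH that node. BSD is not proved; nothing is closed.

References: [Kato2004Asterisque] Thm. 17.4 (1)(2) (p. 273); [GreenbergLNM1716] Conj. 1.11, Thm. 4.1, §1 p. 64; [AbbesUllmo1996] Thm. A;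
[MilneADT2006] Thm. I.7.3 (Cassels); [DokchitserDokchitserMathZ2012] Theorem (1); [MazurTateTeitelbaum1986Invent] §I.10–I.13; tree p583329
(Seed), `…KatoMuRoad` (att-p2 g3), `…AnalyticMuBinderDischarge` (att-p3 g10), `…OrdIsogenyTransport` (ord-3), `…OrdKatoHalfAtTwoIsoPosDiscNecessity`
(cruxlead-19573 g6), `…ByReductionTypeAtTwoAnalyticMuZero` (tower-1 g24).
-/

set_option linter.dupNamespace false
set_option autoImplicit false

noncomputable section

open scoped Classical

namespace Summit.BirchSwinnertonDyer.BirchSwinnertonDyer.Theorems.AlignedTransportAtTwoOfKatoHalf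

open CongruenceSubgroup WeierstrassCurve Field Literature.NumberTheory.EllipticCurves
  Literature.NumberTheory.EllipticCurves.ModularForms
  Literature.NumberTheory.EllipticCurves.Rank1Residual
  Literature.NumberTheory.EllipticCurves.Greenberg1999
  Literature.NumberTheory.GaloisRepresentations
  Literature.NumberTheory.IwasawaTheory
  Summit.BirchSwinnertonDyer.Rank1Residual
  Summit.BirchSwinnertonDyer.Rank1Residual.X1.MuLambda
  Summit.BirchSwinnertonDyer.Rank1Residual.X5
  Summit.BirchSwinnertonDyer.Rank1Residual.F1Sign2
  Summit.BirchSwinnertonDyer.BirchSwinnertonDyer.Theorems.Rank1ResidualX1Defs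
  Summit.BirchSwinnertonDyer.BirchSwinnertonDyer.Theses.AlignedTransportAtTwo
  Summit.BirchSwinnertonDyer.BirchSwinnertonDyer.Theses.ByReductionTypeAtTwo
  Summit.BirchSwinnertonDyer.BirchSwinnertonDyer.Theorems.SteinbergFibreAtTwo
  Summit.BirchSwinnertonDyer.BirchSwinnertonDyer.Theorems.IsogenyMuShift
  Literature.NumberTheory.EllipticCurves.SkinnerUrban2014

/-! ## §1 Per curve -/

section PerCurve

variable (W : WeierstrassCurve ℚ) [W.IsElliptic] [W.IsGloballyMinimal]

/-- **Equality ⟹ divisibility**: Mazur's `2`-adic main conjecture for `W` gives the Kato–Néron half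
`X5.O1.MainConjectureLowerDivisibilityAtTwoOrd W` (a generator of `char X` lifting `ϖ·L₂(f, α)` is in particular an element of `char X`
lifting it). Bookkeeping between the two routes' currencies. [folklore] -/
theorem mainConjectureLowerDivisibilityAtTwoOrd_of_mazurMainConjecture_two (hMC : MazurMainConjecture W 2) :
    O1.MainConjectureLowerDivisibilityAtTwoOrd W := by
  intro κ γ hκ hγ hγ' _ _ f hf ϖ hϖ D
  obtain ⟨_, g, hg, hι⟩ := hMC κ γ hκ hγ hγ' f hf ϖ hϖ D
  exact ⟨g, hg ▸ Ideal.mem_span_singleton_self g, hι⟩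

/-- **The Kato–Néron half AT `W` forces `μ(X(W/ℚ_∞)) = 0`** at every normalised cyclotomic Selmer dual datum, for `W` good ordinary at
`2` with no rational `2`-torsion abscissa (`E[2]` irreducible), granted Kato 17.4 (1)(2) at `2` for `W` (`h17`), modularity (`hmod`) and
Abbes–Ullmo (`hAU`) BY NAME: the half ⟹ Kato's `μ`-part (`X5.O1.katoMuPartAtTwo_of_mainConjectureLowerDivisibilityAtTwoOrd`) ⟹ `μ = 0`
(bsd-2adic `mu_eq_zero_of_katoMuPartAtTwo_of_irr`: Abbes–Ullmo period unit, integral lift, and the tree's analytic `μ₂ = 0` theorem).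
No analytic-`μ` hypothesis, no `BSD₂`. [cite: Kato2004Asterisque, Thm. 17.4 (1)(2) (p. 273)] [cite: AbbesUllmo1996, Thm. A]
[cite: GreenbergLNM1716, §1 Conj. 1.11 (p. 58)] -/
theorem selmerDual_mu_eq_zero_of_lowerDivisibility_of_forall_not_hasRationalTwoTorsionX
    (h17 : ∀ [NeZero (W.conductorNorm ℤ)] (f : CuspForm (Gamma0 (W.conductorNorm ℤ)) 2),
      kato_divisibility_allPrimes W 2 (f := f))
    (hmod : nonempty_modularParametrizationData) (hAU : abbesUllmo_not_dvd_maninConstant_of_not_dvd_level)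
    (hord : IsOrdinaryAt W 2) (ht : ∀ x : ℚ, ¬ HasRationalTwoTorsionX W x)
    (hK : O1.MainConjectureLowerDivisibilityAtTwoOrd W)
    {κ : ZpExtension ℚ 2} {γ : absoluteGaloisGroup ℚ} (hκ : κ.IsCyclotomic) (hγ : κ.IsTopGenerator γ)
    (hγ' : IsCyclotomicVariable 2 γ) (D : W.SelmerDualData κ γ) : D.mu = 0 :=
  mu_eq_zero_of_katoMuPartAtTwo_of_irr W hAU hmod hord (AlignedTransportAtTwoSeed.irr_two_of_forall_not_hasRationalTwoTorsionX W ht)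
    (O1.katoMuPartAtTwo_of_mainConjectureLowerDivisibilityAtTwoOrd W (fun f ↦ h17 f) hK) hκ hγ hγ' D

/-- **`MC₂(W)` for a curve of C2's seed cell from crux 202.** Granted PUB (`hPub` = modularity, GZK, Kato 17.4 (1)(2) at `2`, Greenberg 4.1),
Cassels (`hCassels`), Abbes–Ullmo (`hAU`) BY NAME and route `ByReductionTypeAtTwo`'s crux `OrdKatoHalfAtTwoIso` (`hcrux`, OPEN): for `W`
non-CM, good ordinary at `2`, no rational `2`-torsion abscissa, `r_an = 0`, `BSD₂(W)` — Mazur's `2`-adic main conjecture for `W`. Chain: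
crux 202 ⟹ half at an isogenous `W'` ⟹ half AT `W` (`katoHalf_isogenyInvariant`) ⟹ `μ(X) = 0` ⟹ (p583329's engine, period unit from
Abbes–Ullmo) `MC₂(W)`. The binders `Δ ∉ ℚ²` and `μ(L₂) = 0` of C2 are not needed. [cite: Kato2004Asterisque, Thm. 17.4 (1)(2) (p. 273)]
[cite: GreenbergLNM1716, Thm. 4.1 (p. 102) and §1 p. 64] [cite: MilneADT2006, Thm. I.7.3] [cite: AbbesUllmo1996, Thm. A] -/
theorem mazurMainConjecture_two_of_ordKatoHalfAtTwoIso (hPub : OrdPublishedInputsAtTwo)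
    (hCassels : bsdRHS_eq_of_isIsogenous) (hAU : abbesUllmo_not_dvd_maninConstant_of_not_dvd_level)
    (hcrux : OrdKatoHalfAtTwoIso) (hcm : ¬ W.HasCM) (hord : IsOrdinaryAt W 2)
    (ht : ∀ x : ℚ, ¬ HasRationalTwoTorsionX W x) (hr : W.analyticRank = 0) (hbsd : BSDp W 2) :
    MazurMainConjecture W 2 := by
  obtain ⟨hmod, hGZK, h17, hGr⟩ := hPub
  have hgo : GoodOrd W 2 := hord
  obtain ⟨W', _, _, hiso, hK'⟩ := hcrux W hcm hr hgo
  have hK : O1.MainConjectureLowerDivisibilityAtTwoOrd W :=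
    katoHalf_isogenyInvariant ⟨hmod, hGZK, h17, hGr⟩ hCassels hiso hgo hr hK'
  have hper : realPeriodRat_eq_unit_mul_plusPeriod_two := fun V _ _ hgood hirr _ _ f hf =>
    realPeriodRat_eq_unit_mul_plusPeriod_two_of_abbesUllmo hAU V hgood hirr f hf
  exact AlignedTransportAtTwoSeed.mazurMainConjecture_two_of_bsdp_of_mu_eq_zero W (fun f ↦ h17 W f) hGr hper hmod hGZK hord
    ht hr hbsd fun κ γ hκ hγ hγ' D _ =>
      selmerDual_mu_eq_zero_of_lowerDivisibility_of_forall_not_hasRationalTwoTorsionX W (fun f ↦ h17 W f) hmod hAU hord ht hK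
        hκ hγ hγ' D

omit [W.IsGloballyMinimal] in
/-- **The seed cell has `ρ̄_{W,2}` onto `GL₂(𝔽₂)`**: no rational `2`-torsion abscissa and `Δ_W ∉ ℚ²` (Dokchitser–Dokchitser, tree theorem
`hasSurjectiveModNGaloisRep_two_iff`). [cite: DokchitserDokchitserMathZ2012, Theorem (1)] -/
theorem hasSurjectiveModNGaloisRep_two_of_seedCell (ht : ∀ x : ℚ, ¬ HasRationalTwoTorsionX W x) (hsq : ¬ IsSquare W.Δ) :
    W.HasSurjectiveModNGaloisRep 2 :=
  (hasSurjectiveModNGaloisRep_two_iff W).mpr ⟨AlignedTransportAtTwoMuNecessity.two_nsmul_eq_zero_imp_eq_zero W ht, hsq⟩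

end PerCurve

/-! ## §2 The cells: C2 BY NAME from crux 202 BY NAME (and its `0 < Δ` conjunct) -/

section Cells

/-- **C2 IS A COROLLARY OF CRUX 202 MODULO PRINT.** Granted `OrdPublishedInputsAtTwo` (modularity, Gross–Zagier–Kolyvagin, Kato 17.4 (1)(2)
at `2`, Greenberg 4.1), Cassels' isogeny invariance of the BSD quotient and Abbes–Ullmo's Manin-constant theorem — six PRINT facts BY
NAME — route `ByReductionTypeAtTwo`'s crux `OrdKatoHalfAtTwoIso` (stmt-BirchSwinnertonDyer-19573, OPEN research-grade) IMPLIES route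
`AlignedTransportAtTwo`'s crux C2 `MainConjectureOfRankZeroBSDAtTwo` (stmt-BirchSwinnertonDyer-22298). CONDITIONAL on an open crux; BOTH items
stay open; BSD is not proved by any of this. [cite: Kato2004Asterisque, Thm. 17.4 (1)(2) (p. 273)] [cite: GreenbergLNM1716, Thm. 4.1 (p. 102), Conj. 1.11 (p. 58)]
[cite: AbbesUllmo1996, Thm. A] [cite: MilneADT2006, Thm. I.7.3] -/
theorem mainConjectureOfRankZeroBSDAtTwo_of_ordKatoHalfAtTwoIso (hPub : OrdPublishedInputsAtTwo)
    (hCassels : bsdRHS_eq_of_isIsogenous) (hAU : abbesUllmo_not_dvd_maninConstant_of_not_dvd_level)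
    (hcrux : OrdKatoHalfAtTwoIso) : MainConjectureOfRankZeroBSDAtTwo :=
  fun W _ _ hcm hord ht _ hr _ hbsd =>
    mazurMainConjecture_two_of_ordKatoHalfAtTwoIso W hPub hCassels hAU hcrux hcm hord ht hr hbsd

/-- **The `0 < Δ_W` half of C2 from the REGISTERED conjunct `OrdKatoHalfAtTwoIsoPosDisc`** (the `0 < Δ` conjunct of the PAIR child
stmt-BirchSwinnertonDyer-24097; cell [`ρ̄₂` onto ∧ `0 < Δ`]): granted the same six print facts, for every seed-cell curve `W` with `0 < Δ_W` and
`BSD₂(W)`, `MC₂(W)`. The seed cell lies in that cell (`hasSurjectiveModNGaloisRep_two_of_seedCell`); then bsd-2adic's NECESSITY I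
`mu_eq_zero_of_posDisc` and p583329's engine. CONDITIONAL; nothing closed. [cite: Kato2004Asterisque, Thm. 17.4 (1)(2) (p. 273)]
[cite: DokchitserDokchitserMathZ2012, Theorem (1)] [cite: AbbesUllmo1996, Thm. A] -/
theorem crux_posDisc_of_ordKatoHalfAtTwoIsoPosDisc (hPub : OrdPublishedInputsAtTwo)
    (hCassels : bsdRHS_eq_of_isIsogenous) (hAU : abbesUllmo_not_dvd_maninConstant_of_not_dvd_level)
    (hPos : OrdKatoHalfAtTwoIsoPosDisc) :
    ∀ (W : WeierstrassCurve ℚ) [W.IsElliptic] [W.IsGloballyMinimal], ¬ W.HasCM →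
      IsOrdinaryAt W 2 → (∀ x : ℚ, ¬ HasRationalTwoTorsionX W x) → ¬ IsSquare W.Δ → 0 < W.Δ →
      W.analyticRank = 0 → BSDp W 2 → MazurMainConjecture W 2 := by
  intro W _ _ hcm hord ht hsq hΔ hr hbsd
  obtain ⟨hmod, hGZK, h17, hGr⟩ := hPub
  have hgo : GoodOrd W 2 := hord
  have h2 : W.HasSurjectiveModNGaloisRep 2 := hasSurjectiveModNGaloisRep_two_of_seedCell W ht hsq
  have hper : realPeriodRat_eq_unit_mul_plusPeriod_two := fun V _ _ hgood hirr _ _ f hf =>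
    realPeriodRat_eq_unit_mul_plusPeriod_two_of_abbesUllmo hAU V hgood hirr f hf
  exact AlignedTransportAtTwoSeed.mazurMainConjecture_two_of_bsdp_of_mu_eq_zero W (fun f ↦ h17 W f) hGr hper hmod hGZK hord
    ht hr hbsd fun κ γ hκ hγ hγ' D _ =>
      mu_eq_zero_of_posDisc hPos ⟨hmod, hGZK, h17, hGr⟩ hCassels hAU W hcm hr hgo h2 hΔ hκ hγ hγ' D

end Cells

/-! ## §3 The converse on the seed cell -/

section Converse

/-- **C2 gives crux 202's conclusion on the seed cell with `BSD₂`, at `W' := W`.** `MainConjectureOfRankZeroBSDAtTwo` ⟹ for every non-CM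
`W`, good ordinary at `2`, no rational `2`-torsion abscissa, `Δ_W ∉ ℚ²`, `r_an = 0`, `BSD₂(W)`: the Kato–Néron half
`X5.O1.MainConjectureLowerDivisibilityAtTwoOrd W` (C2's analytic-`μ` binder is the tree theorem of bsd-2adic tower-1 g24, fed by att-p3 g10's
`muFree_of_mainConjectureOfRankZeroBSDAtTwo`; equality ⟹ divisibility). With §2: on {`ρ̄₂` onto, non-CM, `r_an = 0`, good ordinary at `2`,
`BSD₂`} the two routes' cruxes assert the same thing modulo print. Nothing is asserted about either. [cite: GreenbergLNM1716, §1 Conj. 1.11 (p. 58)]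
[cite: MazurTateTeitelbaum1986Invent, §I.10–I.13] -/
theorem lowerDivisibility_on_seedCell_of_mainConjectureOfRankZeroBSDAtTwo (hC2 : MainConjectureOfRankZeroBSDAtTwo) :
    ∀ (W : WeierstrassCurve ℚ) [W.IsElliptic] [W.IsGloballyMinimal], ¬ W.HasCM →
      IsOrdinaryAt W 2 → (∀ x : ℚ, ¬ HasRationalTwoTorsionX W x) → ¬ IsSquare W.Δ →
      W.analyticRank = 0 → BSDp W 2 →
      ∃ (W' : WeierstrassCurve ℚ) (_ : W'.IsElliptic) (_ : W'.IsGloballyMinimal),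
        IsIsogenous W W' ∧ O1.MainConjectureLowerDivisibilityAtTwoOrd W' := by
  intro W _ _ hcm hord ht hsq hr hbsd
  exact ⟨W, ‹_›, ‹_›, isIsogenous_self W,
    mainConjectureLowerDivisibilityAtTwoOrd_of_mazurMainConjecture_two W
      (AlignedTransportAtTwoAnalyticMuDischarge.muFree_of_mainConjectureOfRankZeroBSDAtTwo hC2 W hcm hord ht hsq hr hbsd)⟩

end Converse

end Summit.BirchSwinnertonDyer.BirchSwinnertonDyer.Theorems.AlignedTransportAtTwoOfKatoHalf

end
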